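import Literature.NumberTheory.Automorphic.Liu2021.AppendixC.EtaleH1LevelSemisimple
import Literature.NumberTheory.Automorphic.Liu2021.AppendixC.OmegaHomBlockSelector
import Literature.RingTheory.SimpleModule.SemisimpleOfFaithfulModule
import HarnessLib

/-!
# [Liu 2021, p. 133 (D.3)] the level-`K` Hecke module `ℚ̄_ℓ ⊗ H¹_ét(A_K)` over `𝒜 = ℚ̄_ℓ[ᵗV_ℓ^ℚ(heckeEnd K g) ⊗ 1 : g]`: the block module of an
# irreducible constituent, semisimplicity of `𝒜`, and the realisation `ℚ̄_ℓ ⊗_ℚ (heckeImage K)ᵐᵒᵖ ↠ 𝒜`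

Topic `NumberTheory/Automorphic/Liu2021/AppendixC`; namespace `Literature.NumberTheory.Automorphic.Liu2021.AppendixC.Sec42Data.HeckeTranslates`.
THEOREMS ONLY (no definition, no named fact, no instance, no `sorry`).

Print.  [Liu2021] p. 133: the Hecke algebra `C_c^∞(K\G(𝔸^∞)/K, ℚ)` acts on `A_K` through a finite-dimensional `ℚ`-algebra (★ `heckeImage K`) and
«we have isomorphisms `H¹_B(A_K^st, ℂ) ≃ ⊕_{π^∞} H¹_B(Sh(G,h)_K, ℂ)[(π^∞)^K]` … of `C_c^∞(K\G(𝔸^∞)/K, ℚ)`-modules» (D.3).  On the étale side at one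
prime `ℓ` the level-`K` module is `M := ℚ̄_ℓ ⊗ H¹_ét(A_K)` under the realised Hecke endomorphisms `ᵗV_ℓ^ℚ(heckeEnd K g) ⊗ 1` (★ `HeckeEndomorphism`,
★ `OmegaHomBlockSelector` §1); write `𝒜 ⊆ End_{ℚ̄_ℓ}(M)` for the `ℚ̄_ℓ`-algebra they generate (an `Algebra.adjoin`, kept as an opaque set `S` of generators
in the statements).  This file packages the module-theoretic frame of (D.3) for ONE irreducible constituent `(W, ω)` with a non-zero
`f′ ∈ Hom_𝔾(ι_ℓ ∘ ω, ℚ̄_ℓ ⊗ H¹_ét(A_∞))` (★ `X.omegaHom ι ρW`):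

* §1 `module_finite_baseChange_etaleH1` (`M` is finite-dimensional); `exists_submodule_adjoin_restrictScalars_eq` — the `𝒜`-submodule
  `N₀ = [·]_K⁻¹ f′(ω^K)` (Hecke-stable by ★ `baseChange_dualMap_rationalTateAction_heckeEnd_mem_comap_map`); `ne_bot_of_restrictScalars_eq`
  (`N₀ ≠ 0` when `f′ ≠ 0` on `ω^K`); `isSemisimpleRing_adjoin_baseChange` — under the `G`-level semisimplicity binder `σ = 1 ⊗ rhoEt` semisimple
  (★ `EtaleH1LevelSemisimple.isSemisimpleModule_adjoin_baseChange_etaleH1`) `𝒜` is a SEMISIMPLE ring ([Lam2001FirstCourse] (9.11)).  Simplicity of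
  `N₀` for irreducible `ω` is ★ `eq_bot_or_coe_eq_of_forall_heckeEnd_stable` + ★ `isSimpleModule_of_forall_stable` (consumers instantiate it in
  proofs: the instance `AddCommGroup ↥N₀` on `Submodule ↥𝒜 (ℚ̄_ℓ ⊗ H¹)` is supplied by term, not by synthesis).
* §2 `exists_algHom_tensor_mulOpposite_heckeImage_surjective` — the realisation `c ⊗ h ↦ c · (ᵗV_ℓ^ℚ h ⊗ 1)` is a SURJECTIVE `ℚ̄_ℓ`-algebra map
  `ℚ̄_ℓ ⊗_ℚ (heckeImage K)ᵐᵒᵖ → 𝒜` (the OPPOSITE algebra because `H¹ = (V_ℓ)^∨` is contravariant: `ᵗV_ℓ^ℚ(x y) = ᵗV_ℓ^ℚ(y) ᵗV_ℓ^ℚ(x)`).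

Sequel: ★ `OmegaHomBlockFieldCharacter` (the label character of the block field and the S2′ socket `SocketIso`).  Count-neutral (`--supports`
stmt-HodgeConjecture-24832); HC_CM is proved only modulo the 7 printed citations until rung 0 closes.

## References
* [Liu2021] Y. Liu, *Fourier–Jacobi cycles and arithmetic relative trace formula*, Camb. J. Math. 9 (2021): p. 133 (D.3) (FJcycle.tex l. 5463–5470),
  §4.2 (l. 2154–2166), Thm. 4.18 (1) (l. 2239).
* [Bump1997] D. Bump, *Automorphic Forms and Representations* (1997), §4.2 Prop. 4.2.3 (p. 427).
* [Lam2001FirstCourse] T. Y. Lam, *A First Course in Noncommutative Rings*, 2nd ed. (2001), §9 Prop. (9.11) (p. 146).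
* [MumfordAV1970] D. Mumford, *Abelian Varieties*, §19 Thm. 3.
-/

set_option autoImplicit false

noncomputable section

open CategoryTheory NumberField Function MulAction
open scoped TensorProduct

namespace Literature.NumberTheory.Automorphic.Liu2021.AppendixC

open Literature.AlgebraicGeometry.Motives (AbelianVariety)
open Literature.AlgebraicGeometry.Motives.AbelianVariety (rationalTateModuleMap endAlgebra rationalTateAction rationalTateAction_algebraMap)

variable {F E : Type} [Field F] [NumberField F] [IsTotallyReal F] [Field E] [NumberField E] [Algebra F E]
  [IsTotallyComplex E] [Algebra.IsQuadraticExtension F E]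
variable {P5 : PropC5Data F E} {isotropicAt : ℕ → Prop}

namespace Sec42Data.HeckeTranslates

variable {C : Sec42Data P5 isotropicAt} (T : C.HeckeTranslates) {ℓ : ℕ} [Fact ℓ.Prime]
variable (K : C5.SmallLevel C.S.K₀)
  (hI : ∀ ⦃K K' : C5.SmallLevel C.S.K₀⦄ (f : K' ⟶ K), Function.Injective (rationalTateModuleMap ℓ (C.Atr f)).dualMap)
  (X : C.EtaleHeckeDatum ℓ) (hX : X.rhoEt = T.etHeckeRep ℓ) (ι : ℂ ≃+* AlgebraicClosure ℚ_[ℓ])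
  {W : Type} [AddCommGroup W] [Module ℂ W] (ρW : Representation ℂ C.G W)
  {f : W →ₛₗ[(ι : ℂ →+* AlgebraicClosure ℚ_[ℓ])] AlgebraicClosure ℚ_[ℓ] ⊗[ℚ_[ℓ]] C.etaleH1Tower ℓ} (hf : f ∈ X.omegaHom ι ρW)
  (σ : Representation (AlgebraicClosure ℚ_[ℓ]) C.G (AlgebraicClosure ℚ_[ℓ] ⊗[ℚ_[ℓ]] C.etaleH1Tower ℓ))
  (hσ : ∀ g : C.G, σ g = (X.rhoEt g).baseChange (AlgebraicClosure ℚ_[ℓ]))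

/-! ## §1 The level-`K` module `ℚ̄_ℓ ⊗ H¹_ét(A_K)` over `𝒜 = ℚ̄_ℓ[ᵗV_ℓ^ℚ(heckeEnd K g) ⊗ 1 : g]` and the block module `N₀ = [·]_K⁻¹ f′(ω^K)` -/

variable (ℓ) in
/-- `ℚ̄_ℓ ⊗ H¹_ét(A_K)` is finite-dimensional over `ℚ̄_ℓ` (`H¹_ét(A_K) = (V_ℓ A_K)^∨`, `V_ℓ A_K` finite over `ℚ_ℓ`). [cite: MumfordAV1970, §19 Thm. 3] -/
theorem module_finite_baseChange_etaleH1 :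
    Module.Finite (AlgebraicClosure ℚ_[ℓ]) (AlgebraicClosure ℚ_[ℓ] ⊗[ℚ_[ℓ]] C.etaleH1 ℓ K) := by
  have hℓE : (ℓ : E) ≠ 0 := Nat.cast_ne_zero.2 (Fact.out : ℓ.Prime).ne_zero
  haveI : Module.Finite ℚ_[ℓ] ((C.A K).rationalTateModule ℓ) := by
    haveI := Literature.AlgebraicGeometry.Motives.AbelianVariety.module_finite_tateModule_of_cast_ne_zero (C.A K) ℓ hℓE
    change Module.Finite ℚ_[ℓ] (ℚ_[ℓ] ⊗[ℤ_[ℓ]] (C.A K).tateModule ℓ)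
    infer_instance
  haveI : Module.Finite ℚ_[ℓ] (C.etaleH1 ℓ K) := by
    change Module.Finite ℚ_[ℓ] (Module.Dual ℚ_[ℓ] ((C.A K).rationalTateModule ℓ))
    infer_instance
  infer_instance

include hX hf in
/-- **The block module `N₀ = [·]_K⁻¹ f′(ω^K)` as a module over `𝒜 = ℚ̄_ℓ[ᵗV_ℓ^ℚ(heckeEnd K g) ⊗ 1 : g]`**: the subspace of level-`K` classes under `f′(ω^K)` is
stable under the realised Hecke endomorphisms (★ `baseChange_dualMap_rationalTateAction_heckeEnd_mem_comap_map`), hence under the `ℚ̄_ℓ`-algebra they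
generate. [cite: Liu2021, §4.2 (FJcycle.tex l. 2160–2166) and p. 133 (D.3)] [cite: Bump1997, §4.2 Prop. 4.2.3] -/
theorem exists_submodule_adjoin_restrictScalars_eq (hD : T.IsogenyDescent)
    (S : Set (Module.End (AlgebraicClosure ℚ_[ℓ]) (AlgebraicClosure ℚ_[ℓ] ⊗[ℚ_[ℓ]] C.etaleH1 ℓ K)))
    (hS : S = Set.range fun g : C.G => ((rationalTateAction (C.A K) ℓ (T.heckeEnd hD K g)).dualMap).baseChange (AlgebraicClosure ℚ_[ℓ])) :
    ∃ N₀ : Submodule ↥(Algebra.adjoin (AlgebraicClosure ℚ_[ℓ]) S) (AlgebraicClosure ℚ_[ℓ] ⊗[ℚ_[ℓ]] C.etaleH1 ℓ K),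
      N₀.restrictScalars (AlgebraicClosure ℚ_[ℓ]) =
        ((ρW.fixedPoints (K.1.1 : Subgroup C.G)).map f).comap ((C.toTower ℓ K).baseChange (AlgebraicClosure ℚ_[ℓ])) := by
  have hadj : ∀ r ∈ Algebra.adjoin (AlgebraicClosure ℚ_[ℓ]) S,
      ∀ x ∈ ((ρW.fixedPoints (K.1.1 : Subgroup C.G)).map f).comap ((C.toTower ℓ K).baseChange (AlgebraicClosure ℚ_[ℓ])),
        r x ∈ ((ρW.fixedPoints (K.1.1 : Subgroup C.G)).map f).comap ((C.toTower ℓ K).baseChange (AlgebraicClosure ℚ_[ℓ])) := by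
    intro r hr
    induction hr using Algebra.adjoin_induction with
    | mem s hs =>
      rw [hS] at hs
      obtain ⟨g, rfl⟩ := hs
      intro x hx
      exact T.baseChange_dualMap_rationalTateAction_heckeEnd_mem_comap_map K X hX ι ρW hf hD g hx
    | algebraMap a => intro x hx; simpa using Submodule.smul_mem _ a hx
    | add r₁ r₂ _ _ h₁ h₂ => intro x hx; rw [LinearMap.add_apply]; exact Submodule.add_mem _ (h₁ x hx) (h₂ x hx)
    | mul r₁ r₂ _ _ h₁ h₂ => intro x hx; rw [Module.End.mul_apply]; exact h₁ _ (h₂ x hx)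
  exact ⟨{ carrier := ((ρW.fixedPoints (K.1.1 : Subgroup C.G)).map f).comap ((C.toTower ℓ K).baseChange (AlgebraicClosure ℚ_[ℓ]))
           add_mem' := fun ha hb => Submodule.add_mem _ ha hb
           zero_mem' := Submodule.zero_mem _
           smul_mem' := fun r x hx => hadj r.1 r.2 x hx }, Submodule.ext fun _ => Iff.rfl⟩

include hI hX hf in
/-- `N₀ ≠ 0` as soon as `f′ ≠ 0` on `ω^K` (the values of `f′` on `ω^K` are level-`K` classes, ★ `apply_mem_range_toTower_baseChange`).
[cite: Liu2021, Thm. 4.18 (1) (FJcycle.tex l. 2239) and §4.2 (l. 2158–2166)] -/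
theorem ne_bot_of_restrictScalars_eq (hD : T.IsogenyDescent)
    (hf0 : ∃ w ∈ ρW.fixedPoints (K.1.1 : Subgroup C.G), f w ≠ 0)
    {𝒜 : Subalgebra (AlgebraicClosure ℚ_[ℓ]) (Module.End (AlgebraicClosure ℚ_[ℓ]) (AlgebraicClosure ℚ_[ℓ] ⊗[ℚ_[ℓ]] C.etaleH1 ℓ K))}
    (N₀ : Submodule ↥𝒜 (AlgebraicClosure ℚ_[ℓ] ⊗[ℚ_[ℓ]] C.etaleH1 ℓ K))
    (hN₀ : N₀.restrictScalars (AlgebraicClosure ℚ_[ℓ]) =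
      ((ρW.fixedPoints (K.1.1 : Subgroup C.G)).map f).comap ((C.toTower ℓ K).baseChange (AlgebraicClosure ℚ_[ℓ]))) :
    N₀ ≠ ⊥ := by
  obtain ⟨w, hw, hfw⟩ := hf0
  obtain ⟨x, hx⟩ := T.apply_mem_range_toTower_baseChange K hI X hX ι ρW hf hD hw
  intro hbot
  have hxN : x ∈ N₀.restrictScalars (AlgebraicClosure ℚ_[ℓ]) := by
    rw [hN₀, Submodule.mem_comap, hx]
    exact Submodule.mem_map.2 ⟨w, hw, rfl⟩
  rw [Submodule.restrictScalars_mem, hbot, Submodule.mem_bot] at hxN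
  apply hfw
  rw [← hx, hxN, map_zero]

include hI hX hσ in
/-- **`𝒜 = ℚ̄_ℓ[ᵗV_ℓ^ℚ(heckeEnd K g) ⊗ 1 : g]` is a SEMISIMPLE ring** when `σ = 1 ⊗ rhoEt` is a semisimple `𝔾(𝔸_F^∞)`-module: `ℚ̄_ℓ ⊗ H¹_ét(A_K)` is then a
semisimple `𝒜`-module (★ `isSemisimpleModule_adjoin_baseChange_etaleH1`), faithful and finite-dimensional ([Lam2001FirstCourse] (9.11), ★
`isSemisimpleRing_of_isSemisimpleModule`). [cite: Liu2021, p. 133 (D.3)] [cite: Lam2001FirstCourse, §9 Prop. (9.11) p. 146] -/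
theorem isSemisimpleRing_adjoin_baseChange (hD : T.IsogenyDescent) [σ.IsSemisimpleRepresentation]
    (S : Set (Module.End (AlgebraicClosure ℚ_[ℓ]) (AlgebraicClosure ℚ_[ℓ] ⊗[ℚ_[ℓ]] C.etaleH1 ℓ K)))
    (hS : S = Set.range fun g : C.G => ((rationalTateAction (C.A K) ℓ (T.heckeEnd hD K g)).dualMap).baseChange (AlgebraicClosure ℚ_[ℓ])) :
    IsSemisimpleRing ↥(Algebra.adjoin (AlgebraicClosure ℚ_[ℓ]) S) := by
  have hσ' : ∀ g : C.G, σ g = (T.etHeckeRep ℓ g).baseChange (AlgebraicClosure ℚ_[ℓ]) := fun g => by rw [hσ, hX]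
  haveI := module_finite_baseChange_etaleH1 (C := C) ℓ K
  subst hS
  haveI := T.isSemisimpleModule_adjoin_baseChange_etaleH1 ℓ K hI σ hσ' hD
  exact Literature.RingTheory.SimpleModule.isSemisimpleRing_of_isSemisimpleModule _


/-! ## §2 The realisation `ℚ̄_ℓ ⊗_ℚ (heckeImage K)ᵐᵒᵖ ↠ 𝒜` -/

set_option maxHeartbeats 400000 in
/-- **The realisation of `ℚ̄_ℓ ⊗_ℚ (heckeImage K)ᵐᵒᵖ` ONTO `𝒜 = ℚ̄_ℓ[ᵗV_ℓ^ℚ(heckeEnd K g) ⊗ 1 : g]`.**  The map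
`h ↦ ᵗV_ℓ^ℚ(h) ⊗ 1` is a `ℚ`-algebra ANTI-homomorphism `heckeImage K → End_{ℚ̄_ℓ}(ℚ̄_ℓ ⊗ H¹_ét(A_K))` (`H¹` is contravariant), i.e. an algebra
homomorphism out of the opposite algebra, with values in `𝒜` (★ `baseChange_dualMap_rationalTateAction_mem_adjoin`); its `ℚ̄_ℓ`-linear extension
`c ⊗ h ↦ c · (ᵗV_ℓ^ℚ(h) ⊗ 1)` is an `ℚ̄_ℓ`-algebra map onto `𝒜` (the generators `ᵗV_ℓ^ℚ(heckeEnd K g) ⊗ 1` are values).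
[cite: Liu2021, p. 133 (before (D.3), FJcycle.tex l. 5463)] [cite: MumfordAV1970, §19 Thm. 3] -/
theorem exists_algHom_tensor_mulOpposite_heckeImage_surjective (hD : T.IsogenyDescent)
    (S : Set (Module.End (AlgebraicClosure ℚ_[ℓ]) (AlgebraicClosure ℚ_[ℓ] ⊗[ℚ_[ℓ]] C.etaleH1 ℓ K)))
    (hS : S = Set.range fun g : C.G => ((rationalTateAction (C.A K) ℓ (T.heckeEnd hD K g)).dualMap).baseChange (AlgebraicClosure ℚ_[ℓ])) :
    ∃ Φ : AlgebraicClosure ℚ_[ℓ] ⊗[ℚ] (↥(T.heckeImage hD K))ᵐᵒᵖ →ₐ[AlgebraicClosure ℚ_[ℓ]] ↥(Algebra.adjoin (AlgebraicClosure ℚ_[ℓ]) S),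
      Function.Surjective Φ ∧
      ∀ x : ↥(T.heckeImage hD K),
        ((Φ ((1 : AlgebraicClosure ℚ_[ℓ]) ⊗ₜ[ℚ] MulOpposite.op x) : ↥(Algebra.adjoin (AlgebraicClosure ℚ_[ℓ]) S)) :
            Module.End (AlgebraicClosure ℚ_[ℓ]) (AlgebraicClosure ℚ_[ℓ] ⊗[ℚ_[ℓ]] C.etaleH1 ℓ K)) =
          ((rationalTateAction (C.A K) ℓ (x : (C.A K).endAlgebra)).dualMap).baseChange (AlgebraicClosure ℚ_[ℓ]) := by
  classical
  -- OPAQUE abbreviation `op x = ᵗV_ℓ^ℚ x ⊗ 1`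
  obtain ⟨op, hop⟩ : ∃ op : (C.A K).endAlgebra → Module.End (AlgebraicClosure ℚ_[ℓ]) (AlgebraicClosure ℚ_[ℓ] ⊗[ℚ_[ℓ]] C.etaleH1 ℓ K),
      op = fun x => ((rationalTateAction (C.A K) ℓ x).dualMap).baseChange (AlgebraicClosure ℚ_[ℓ]) := ⟨_, rfl⟩
  have hop' : ∀ x, op x = ((rationalTateAction (C.A K) ℓ x).dualMap).baseChange (AlgebraicClosure ℚ_[ℓ]) := fun x => by rw [hop]
  have op_mul : ∀ x y, op (x * y) = op y * op x := fun x y => by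
    rw [hop', hop', hop', Module.End.mul_eq_comp]
    exact baseChange_dualMap_rationalTateAction_mul ℓ K x y
  have op_add : ∀ x y, op (x + y) = op x + op y := fun x y => by
    rw [hop', hop', hop']
    exact baseChange_dualMap_rationalTateAction_add ℓ K x y
  have op_one : op 1 = 1 := by rw [hop', baseChange_dualMap_rationalTateAction_one ℓ K, Module.End.one_eq_id]
  have op_zero : op 0 = 0 := by rw [hop', baseChange_dualMap_rationalTateAction_zero ℓ K]
  have op_algebraMap : ∀ q : ℚ, op (algebraMap ℚ (C.A K).endAlgebra q) =
      algebraMap (AlgebraicClosure ℚ_[ℓ]) (Module.End (AlgebraicClosure ℚ_[ℓ]) (AlgebraicClosure ℚ_[ℓ] ⊗[ℚ_[ℓ]] C.etaleH1 ℓ K))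
        (algebraMap ℚ (AlgebraicClosure ℚ_[ℓ]) q) := by
    intro q
    have h1 : (rationalTateAction (C.A K) ℓ (algebraMap ℚ (C.A K).endAlgebra q)).dualMap =
        (algebraMap ℚ ℚ_[ℓ] q) • (LinearMap.id : C.etaleH1 ℓ K →ₗ[ℚ_[ℓ]] C.etaleH1 ℓ K) := by
      rw [rationalTateAction_algebraMap]
      ext φ v
      simp [LinearMap.dualMap_apply, Algebra.algebraMap_eq_smul_one]
    have h2 : algebraMap ℚ_[ℓ] (AlgebraicClosure ℚ_[ℓ]) (algebraMap ℚ ℚ_[ℓ] q) = algebraMap ℚ (AlgebraicClosure ℚ_[ℓ]) q := by simp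
    rw [hop', h1, LinearMap.baseChange_smul, LinearMap.baseChange_id, ← algebraMap_smul (AlgebraicClosure ℚ_[ℓ]) (algebraMap ℚ ℚ_[ℓ] q),
      ← Module.End.one_eq_id, ← Algebra.algebraMap_eq_smul_one, h2]
  have op_mem : ∀ x ∈ T.heckeImage hD K, op x ∈ Algebra.adjoin (AlgebraicClosure ℚ_[ℓ]) S := by
    intro x hx
    rw [hop', hS]
    exact T.baseChange_dualMap_rationalTateAction_mem_adjoin ℓ K hD hx
  -- the `ℚ`-algebra structure on `𝒜` through `ℚ̄_ℓ` (local)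
  letI algQ : Algebra ℚ ↥(Algebra.adjoin (AlgebraicClosure ℚ_[ℓ]) S) :=
    ((algebraMap (AlgebraicClosure ℚ_[ℓ]) ↥(Algebra.adjoin (AlgebraicClosure ℚ_[ℓ]) S)).comp
      (algebraMap ℚ (AlgebraicClosure ℚ_[ℓ]))).toAlgebra' fun q x => Algebra.commutes (algebraMap ℚ (AlgebraicClosure ℚ_[ℓ]) q) x
  haveI : IsScalarTower ℚ (AlgebraicClosure ℚ_[ℓ]) ↥(Algebra.adjoin (AlgebraicClosure ℚ_[ℓ]) S) :=
    IsScalarTower.of_algebraMap_eq fun _ => rfl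
  -- `Φ₀ : (heckeImage K)ᵐᵒᵖ →ₐ[ℚ] 𝒜`, `op h ↦ ᵗV_ℓ^ℚ(h) ⊗ 1`
  let Φ₀ : (↥(T.heckeImage hD K))ᵐᵒᵖ →ₐ[ℚ] ↥(Algebra.adjoin (AlgebraicClosure ℚ_[ℓ]) S) :=
    { toFun := fun x => ⟨op ((MulOpposite.unop x : ↥(T.heckeImage hD K)) : (C.A K).endAlgebra), op_mem _ (MulOpposite.unop x).2⟩
      map_one' := Subtype.ext (by
        change op (((MulOpposite.unop (1 : (↥(T.heckeImage hD K))ᵐᵒᵖ)) : ↥(T.heckeImage hD K)) : (C.A K).endAlgebra) = _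
        rw [MulOpposite.unop_one, OneMemClass.coe_one, op_one]
        rfl)
      map_mul' := fun x y => Subtype.ext (by
        change op (((MulOpposite.unop (x * y)) : ↥(T.heckeImage hD K)) : (C.A K).endAlgebra) =
          op ((MulOpposite.unop x : ↥(T.heckeImage hD K)) : (C.A K).endAlgebra) * op ((MulOpposite.unop y : ↥(T.heckeImage hD K)) : (C.A K).endAlgebra)
        rw [MulOpposite.unop_mul, Subalgebra.coe_mul, op_mul])
      map_zero' := Subtype.ext (by
        change op (((MulOpposite.unop (0 : (↥(T.heckeImage hD K))ᵐᵒᵖ)) : ↥(T.heckeImage hD K)) : (C.A K).endAlgebra) = _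
        rw [MulOpposite.unop_zero, ZeroMemClass.coe_zero, op_zero]
        rfl)
      map_add' := fun x y => Subtype.ext (by
        change op (((MulOpposite.unop (x + y)) : ↥(T.heckeImage hD K)) : (C.A K).endAlgebra) =
          op ((MulOpposite.unop x : ↥(T.heckeImage hD K)) : (C.A K).endAlgebra) + op ((MulOpposite.unop y : ↥(T.heckeImage hD K)) : (C.A K).endAlgebra)
        rw [MulOpposite.unop_add, AddMemClass.coe_add, op_add])
      commutes' := fun q => Subtype.ext (by
        change op (((MulOpposite.unop (algebraMap ℚ (↥(T.heckeImage hD K))ᵐᵒᵖ q)) : ↥(T.heckeImage hD K)) : (C.A K).endAlgebra) =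
          ((algebraMap (AlgebraicClosure ℚ_[ℓ]) ↥(Algebra.adjoin (AlgebraicClosure ℚ_[ℓ]) S) (algebraMap ℚ (AlgebraicClosure ℚ_[ℓ]) q) :
            ↥(Algebra.adjoin (AlgebraicClosure ℚ_[ℓ]) S)) : Module.End (AlgebraicClosure ℚ_[ℓ]) (AlgebraicClosure ℚ_[ℓ] ⊗[ℚ_[ℓ]] C.etaleH1 ℓ K))
        rw [MulOpposite.algebraMap_apply, MulOpposite.unop_op, Subalgebra.coe_algebraMap, op_algebraMap, Subalgebra.coe_algebraMap]) }
  have hΦ₀ : ∀ x : ↥(T.heckeImage hD K), ((Φ₀ (MulOpposite.op x) : ↥(Algebra.adjoin (AlgebraicClosure ℚ_[ℓ]) S)) :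
      Module.End (AlgebraicClosure ℚ_[ℓ]) (AlgebraicClosure ℚ_[ℓ] ⊗[ℚ_[ℓ]] C.etaleH1 ℓ K)) = op (x : (C.A K).endAlgebra) := fun _ => rfl
  -- `Φ = ℚ̄_ℓ ⊗ Φ₀`
  let Φ : AlgebraicClosure ℚ_[ℓ] ⊗[ℚ] (↥(T.heckeImage hD K))ᵐᵒᵖ →ₐ[AlgebraicClosure ℚ_[ℓ]] ↥(Algebra.adjoin (AlgebraicClosure ℚ_[ℓ]) S) :=
    Algebra.TensorProduct.lift (Algebra.ofId (AlgebraicClosure ℚ_[ℓ]) _) Φ₀ fun c y => Algebra.commutes c (Φ₀ y)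
  have hΦ : ∀ (c : AlgebraicClosure ℚ_[ℓ]) (y : (↥(T.heckeImage hD K))ᵐᵒᵖ), Φ (c ⊗ₜ[ℚ] y) = c • Φ₀ y := fun c y => by
    change Algebra.TensorProduct.lift _ _ _ (c ⊗ₜ[ℚ] y) = _
    rw [Algebra.TensorProduct.lift_tmul, Algebra.ofId_apply, Algebra.smul_def]
  refine ⟨Φ, ?_, fun x => ?_⟩
  · -- surjective: the range is a subalgebra containing the generators
    rintro ⟨y, hy⟩
    induction hy using Algebra.adjoin_induction with
    | mem s hs =>
      rw [hS] at hs
      obtain ⟨g, rfl⟩ := hs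
      refine ⟨(1 : AlgebraicClosure ℚ_[ℓ]) ⊗ₜ[ℚ] MulOpposite.op ⟨T.heckeEnd hD K g, T.heckeEnd_mem_heckeImage hD K g⟩, Subtype.ext ?_⟩
      rw [hΦ, one_smul, hΦ₀, hop']
    | algebraMap c => exact ⟨algebraMap (AlgebraicClosure ℚ_[ℓ]) _ c, by rw [AlgHom.commutes]; rfl⟩
    | add x y _ _ hx hy =>
      obtain ⟨s, hs⟩ := hx
      obtain ⟨t, ht⟩ := hy
      exact ⟨s + t, by rw [map_add, hs, ht]; rfl⟩
    | mul x y _ _ hx hy =>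
      obtain ⟨s, hs⟩ := hx
      obtain ⟨t, ht⟩ := hy
      exact ⟨s * t, by rw [map_mul, hs, ht]; rfl⟩
  · rw [hΦ, one_smul, hΦ₀, hop']


end Sec42Data.HeckeTranslates

end Literature.NumberTheory.Automorphic.Liu2021.AppendixC

end
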